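import Summits.BirchSwinnertonDyer.BirchSwinnertonDyer.Theorems.PrintCf2SplitBadTwoLineDoubleCosetPlaces
import Summits.BirchSwinnertonDyer.BirchSwinnertonDyer.Theorems.PrintCf2RubinValueTwoLinePinSlotOneDefectAt
import Summits.BirchSwinnertonDyer.BirchSwinnertonDyer.Theorems.EisensteinPrimesUnramifiedKerReps
import Literature.NumberTheory.EllipticCurves.Rubin1991.TwoVariableSelmerCoefficientTwist
import HarnessLib

/-!
# M-LINE-PIN, (C2b-tors) part 3: the `v̄`-condition on lifts at FINITELY MANY REPRESENTATIVES — over a `ℤ_p`-line in which `𝔮` is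
# finitely decomposed (`¬ D_𝔮 ≤ ker κ`), Greenberg's strict condition at `𝔮` for every conjugate of a class of `H¹(K_∞, M)` is the
# condition at the `p^m` conjugates `conj_{(γⁿ)⁻¹}`, `n < p^m`; hence the image of slot-1 control is cut out by `p^m` vanishing conditions

Cell `bsd-print-cf2`, width seat `bsd-line-cf2c-w2` g4 (prover-bsd-line-cf2c-w2-g4-0), planner g19's named piece M-LINE-PIN for the DECIDING
crux child `MainConjClauseAtSplitTwoQuad` (stmt-BirchSwinnertonDyer-24086); towards the DEFECT EMBEDDING (the cokernel of slot-1 control has finite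
`p`-torsion type), the input `(Ob, hOb, hN)` of part 2's `LinePinDefect.isTorsion₂_of_slotOne_control`. `--supports stmt-BirchSwinnertonDyer-24086
--as helper`, Theses-free. HONEST FRAMING: generic Galois-cohomological bookkeeping (every number field `K : Type`, prime `p`, `ℤ_p`-line `κ`,
place `𝔮`, discrete `M`) — -w8 g4's (DC) σ-bookkeeping (p691253/p697464, there for a line RAMIFIED at `v̄` and the condition at `D_v̄`) redone
for a place that is merely FINITELY DECOMPOSED in the line and for Greenberg's STRICT (inertia) condition; no summit statement is proved by this seat;
BSD is not proved by any of this. THEOREMS ONLY (no definition, no named fact, no `sorry`).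

* §1 `resOfLe_inf_inertia_conjH1_eq_zero_iff_of_mem_decomp` — for `τ ∈ D_𝔮` and `s ∈ H¹(K_∞, M)`:
  `res_{ker κ ⊓ I_𝔮}(conj_τ s) = 0 ↔ res_{ker κ ⊓ I_𝔮} s = 0` ((DC-2) with `I_𝔮 ⊴ D_𝔮`, `UnramifiedKerReps.conj_mem_inertia_of_mem_decomp`).
* §2 **`forall_resOfLe_inf_inertia_conjH1_eq_zero_iff_forall_lt`** — `τ₁ ∈ D_𝔮` with `κ τ₁ ≠ 1` (valuation `m`), `γ` a topological generator:
  `(∀ σ, res_{ker κ ⊓ I_𝔮}(conj_σ s) = 0) ↔ (∀ n < p^m, res_{ker κ ⊓ I_𝔮}(conj_{(γⁿ)⁻¹} s) = 0)` (every `σ⁻¹ = h γⁿ τ`, (DC) part 4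
  `exists_eq_kerSubgroup_mul_pow_mul` with `S = D_𝔮`, so `σ = τ⁻¹ (γⁿ)⁻¹ h⁻¹` and `conj_{h⁻¹}` is trivial on `H¹(ker κ, ·)`);
  `forall_mem_greenbergKer_bdpData_iff_forall_lt` — the same for the Greenberg condition of `bdpData M p 𝔮` at `𝔮` (`bdpData_self`,
  `mem_greenbergKer_strictDatum_iff_resOfLe`).
* §3 **`mem_range_lineRes_unr_iff_exists_lift_forall_lt`** — with a partner `κ₂` unramified outside `𝔮` ((C2a) `mem_range_lineRes_unr_iff_exists_lift`):
  a class of `H¹_nr(K̃_∞, M)` is in the image of slot-1 control iff it has a lift `y ∈ H¹(K_∞, M)` with the `p^m` VANISHINGS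
  `res_{ker κ ⊓ I_𝔮}(conj_{(γⁿ)⁻¹} y) = 0`, `n < p^m` — the finitely many «places of `K_∞` above `v̄`» of the memo's (C2).
presearch: Neukirch ANT I §9 (primes above = double cosets), Serre CG I §2.5, Greenberg–Vatsal 2000 §2 pp. 17–21 — tree theorems ((DC) parts 1/4,
(C2a)); assembly, no new fact. beyond-print theorem: no.

References: [NeukirchANT1999] Ch. I §9 p. 54; [SerreGaloisCohomology1997] I §2.5; [GreenbergVatsal2000] §2 pp. 17–21; [GreenbergLNM1716] §3 L. 3.2.
-/

noncomputable section

open scoped Classical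

-- the summit namespace `Summit.BirchSwinnertonDyer.BirchSwinnertonDyer` repeats the problem name by design (D-0017)
set_option linter.dupNamespace false
set_option autoImplicit false

open NumberField IsDedekindDomain Field
open Literature.NumberTheory.EllipticCurves Literature.NumberTheory.EllipticCurves.GreenbergSelmer
  Literature.NumberTheory.EllipticCurves.GreenbergVatsal2000 Literature.NumberTheory.EllipticCurves.KellerYin2024
  Literature.NumberTheory.GaloisRepresentations
  Summit.BirchSwinnertonDyer.BirchSwinnertonDyer.Theorems.PrintCf2

namespace Summit.BirchSwinnertonDyer.BirchSwinnertonDyer.Theorems.PrintCf2.LinePinDefect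

variable {K : Type} [Field K] [NumberField K] {p : ℕ} [Fact p.Prime] (κ : ZpExtension K p)
  (M : Type) [AddCommGroup M] [DistribMulAction (absoluteGaloisGroup K) M] [TopologicalSpace M] [DiscreteTopology M]
  (𝔮 : HeightOneSpectrum (𝓞 K))

/-! ## §1. Strictness at `𝔮` is invariant under conjugation by the decomposition group -/

/-- **`res_{ker κ ⊓ I_𝔮}(conj_τ s) = 0` when `res_{ker κ ⊓ I_𝔮} s = 0`, for `τ ∈ D_𝔮`**: on a cocycle `z` with `z(x) = x a₀ − a₀` on `ker κ ⊓ I_𝔮`,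
`τ • z(τ⁻¹ x τ) = x (τ a₀) − τ a₀` because `τ⁻¹ x τ ∈ ker κ ⊓ I_𝔮` (`I_𝔮 ⊴ D_𝔮`, `ker κ ⊴ Γ_K`). (DC-2) of -w8 g4 with the inertia group in place of
the decomposition group. [cite: SerreGaloisCohomology1997, I §2.5] [cite: NeukirchANT1999, Ch. I §9 (9.6)] -/
theorem resOfLe_inf_inertia_conjH1_eq_zero_of_mem_decomp {τ : absoluteGaloisGroup K} (hτ : τ ∈ decomp 𝔮) (s : subgroupH1 κ.kerSubgroup M)
    (hs : resOfLe M (inf_le_left : κ.kerSubgroup ⊓ inertia 𝔮 ≤ κ.kerSubgroup) s = 0) :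
    resOfLe M (inf_le_left : κ.kerSubgroup ⊓ inertia 𝔮 ≤ κ.kerSubgroup) (conjH1 κ.kerSubgroup M τ s) = 0 := by
  obtain ⟨z, rfl⟩ := oneCocycleClass_surjective _ s
  obtain ⟨a₀, ha₀⟩ := (CocycleCriteria.resOfLe_oneCocycleClass_eq_zero_iff (inf_le_left : κ.kerSubgroup ⊓ inertia 𝔮 ≤ κ.kerSubgroup) z).mp hs
  refine (CocycleCriteria.conjH1_oneCocycleClass_mem_ker_resOfLe_iff (inf_le_left : κ.kerSubgroup ⊓ inertia 𝔮 ≤ κ.kerSubgroup) τ z).mpr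
    ⟨τ • a₀, fun x ↦ ?_⟩
  have hx' : τ⁻¹ * (x : absoluteGaloisGroup K) * τ ∈ κ.kerSubgroup ⊓ inertia 𝔮 :=
    Subgroup.mem_inf.mpr ⟨conj_mem_of_normal κ.kerSubgroup τ ⟨(x : absoluteGaloisGroup K), (Subgroup.mem_inf.mp x.2).1⟩,
      UnramifiedKerReps.conj_mem_inertia_of_mem_decomp 𝔮 hτ (Subgroup.mem_inf.mp x.2).2⟩
  have heq : subgroupConj κ.kerSubgroup τ (Subgroup.inclusion (inf_le_left : κ.kerSubgroup ⊓ inertia 𝔮 ≤ κ.kerSubgroup) x) =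
      Subgroup.inclusion (inf_le_left : κ.kerSubgroup ⊓ inertia 𝔮 ≤ κ.kerSubgroup) ⟨τ⁻¹ * (x : absoluteGaloisGroup K) * τ, hx'⟩ :=
    Subtype.ext rfl
  rw [heq, ha₀]
  change τ • ((τ⁻¹ * (x : absoluteGaloisGroup K) * τ) • a₀ - a₀) = (x : absoluteGaloisGroup K) • τ • a₀ - τ • a₀
  rw [smul_sub, smul_smul, smul_smul, ← mul_assoc, ← mul_assoc, mul_inv_cancel, one_mul]

/-- **`res_{ker κ ⊓ I_𝔮}(conj_τ s) = 0 ↔ res_{ker κ ⊓ I_𝔮} s = 0` for `τ ∈ D_𝔮`** (conjugate back with `τ⁻¹ ∈ D_𝔮`).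
[cite: SerreGaloisCohomology1997, I §2.5] -/
theorem resOfLe_inf_inertia_conjH1_eq_zero_iff_of_mem_decomp {τ : absoluteGaloisGroup K} (hτ : τ ∈ decomp 𝔮) (s : subgroupH1 κ.kerSubgroup M) :
    resOfLe M (inf_le_left : κ.kerSubgroup ⊓ inertia 𝔮 ≤ κ.kerSubgroup) (conjH1 κ.kerSubgroup M τ s) = 0 ↔
      resOfLe M (inf_le_left : κ.kerSubgroup ⊓ inertia 𝔮 ≤ κ.kerSubgroup) s = 0 := by
  refine ⟨fun h ↦ ?_, resOfLe_inf_inertia_conjH1_eq_zero_of_mem_decomp κ M 𝔮 hτ s⟩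
  have h' := resOfLe_inf_inertia_conjH1_eq_zero_of_mem_decomp κ M 𝔮 ((decomp 𝔮).inv_mem hτ) _ h
  have hcomp : conjH1 κ.kerSubgroup M τ⁻¹ (conjH1 κ.kerSubgroup M τ s) = s := by
    rw [← AddMonoidHom.comp_apply, ← conjH1_mul_holds κ.kerSubgroup M, inv_mul_cancel, conjH1_one_holds κ.kerSubgroup M, AddMonoidHom.id_apply]
  rwa [hcomp] at h'

/-! ## §2. The condition at every conjugate is the condition at `p^m` representatives -/

/-- **Strictness at `𝔮` at every prime of `K_∞` above `𝔮` is strictness at the `p^m` conjugates `conj_{(γⁿ)⁻¹}`, `n < p^m`** — for a `ℤ_p`-line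
`κ` with a DECOMPOSITION element `τ₁ ∈ D_𝔮` of value `κ τ₁ ≠ 1` (valuation `m`: `𝔮` does not split completely in `K_∞`), a topological generator `γ`
and any `s ∈ H¹(Gal(K̄/K_∞), M)`: `(∀ σ, res_{ker κ ⊓ I_𝔮}(conj_σ s) = 0) ↔ (∀ n < p^m, res_{ker κ ⊓ I_𝔮}(conj_{(γⁿ)⁻¹} s) = 0)`. Proof: `σ⁻¹ = h γⁿ τ`
(`LineDoubleCoset.exists_eq_kerSubgroup_mul_pow_mul` for the closed `S = D_𝔮`), so `conj_σ = conj_{τ⁻¹} conj_{(γⁿ)⁻¹} conj_{h⁻¹}` with `conj_{h⁻¹} = id`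
on `H¹(ker κ, ·)` and §1 for `τ⁻¹ ∈ D_𝔮`. [cite: NeukirchANT1999, Ch. I §9 p. 54] [cite: SerreGaloisCohomology1997, I §2.5] -/
theorem forall_resOfLe_inf_inertia_conjH1_eq_zero_iff_forall_lt {τ₁ : absoluteGaloisGroup K} (hτ₁ : τ₁ ∈ decomp 𝔮) (hne : κ τ₁ ≠ 1)
    {γ : absoluteGaloisGroup K} (hγ : κ.IsTopGenerator γ) (s : subgroupH1 κ.kerSubgroup M) :
    (∀ σ : absoluteGaloisGroup K, resOfLe M (inf_le_left : κ.kerSubgroup ⊓ inertia 𝔮 ≤ κ.kerSubgroup) (conjH1 κ.kerSubgroup M σ s) = 0) ↔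
      ∀ n : ℕ, n < p ^ ((κ τ₁).toAdd).valuation →
        resOfLe M (inf_le_left : κ.kerSubgroup ⊓ inertia 𝔮 ≤ κ.kerSubgroup) (conjH1 κ.kerSubgroup M (γ ^ n)⁻¹ s) = 0 := by
  refine ⟨fun h n _ ↦ h (γ ^ n)⁻¹, fun h σ ↦ ?_⟩
  obtain ⟨h', n, τ, hh', hn, hτ, hσ⟩ :=
    LineDoubleCoset.exists_eq_kerSubgroup_mul_pow_mul κ (decomp 𝔮) (AnomalousLocalTorsion.isClosed_decomp 𝔮) hτ₁ hne hγ σ⁻¹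
  have hσ' : σ = τ⁻¹ * (γ ^ n)⁻¹ * h'⁻¹ := by
    rw [← inv_inv σ, hσ, mul_inv_rev, mul_inv_rev, mul_assoc]
  rw [hσ', conjH1_mul_holds κ.kerSubgroup M, conjH1_mul_holds κ.kerSubgroup M, AddMonoidHom.comp_apply, AddMonoidHom.comp_apply,
    conjH1_of_mem_holds κ.kerSubgroup M (κ.kerSubgroup.inv_mem hh'), AddMonoidHom.id_apply,
    resOfLe_inf_inertia_conjH1_eq_zero_iff_of_mem_decomp κ M 𝔮 ((decomp 𝔮).inv_mem hτ)]
  exact h n hn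

/-- **The Greenberg condition of `bdpData M p 𝔮` AT `𝔮` for every conjugate is the `p^m` vanishings** (`bdpData_self`: at `𝔮` the datum is STRICT,
`M⁺_𝔮 = 0`, and its Greenberg kernel is «`res_{ker κ ⊓ I_𝔮} = 0`», `mem_greenbergKer_strictDatum_iff_resOfLe`).
[cite: Greenberg1989, §1 p. 98 (4)] [cite: NeukirchANT1999, Ch. I §9 p. 54] -/
theorem forall_mem_greenbergKer_bdpData_iff_forall_lt (h𝔮 : ((p : ℕ) : 𝓞 K) ∈ 𝔮.asIdeal) {τ₁ : absoluteGaloisGroup K} (hτ₁ : τ₁ ∈ decomp 𝔮)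
    (hne : κ τ₁ ≠ 1) {γ : absoluteGaloisGroup K} (hγ : κ.IsTopGenerator γ) (s : subgroupH1 κ.kerSubgroup M) :
    (∀ σ : absoluteGaloisGroup K, conjH1 κ.kerSubgroup M σ s ∈ ((Castella2018.AcSelmer.bdpData M p 𝔮) 𝔮 h𝔮).greenbergKer κ.kerSubgroup) ↔
      ∀ n : ℕ, n < p ^ ((κ τ₁).toAdd).valuation →
        resOfLe M (inf_le_left : κ.kerSubgroup ⊓ inertia 𝔮 ≤ κ.kerSubgroup) (conjH1 κ.kerSubgroup M (γ ^ n)⁻¹ s) = 0 := by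
  rw [← forall_resOfLe_inf_inertia_conjH1_eq_zero_iff_forall_lt κ M 𝔮 hτ₁ hne hγ s]
  refine forall_congr' fun σ ↦ ?_
  rw [Castella2018.AcSelmer.bdpData_self p 𝔮 h𝔮, mem_greenbergKer_strictDatum_iff_resOfLe]

/-! ## §3. The image of slot-1 control is cut out by the `p^m` vanishings -/

variable {κ M 𝔮} {κ₂ : ZpExtension K p} {g : unrSelmer κ M 𝔮 ∅ →+ unrSelmer₂ κ κ₂ M 𝔮}
  (hg : ∀ t : unrSelmer κ M 𝔮 ∅,
    ((g t : unrSelmer₂ κ κ₂ M 𝔮) : subgroupH1 (ZpExtension.pairKer κ κ₂) M) =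
      resOfLe M (ZpExtension.pairKer_le_left κ κ₂) (t : subgroupH1 κ.kerSubgroup M))
include hg

/-- **IMAGE OF SLOT-1 CONTROL = LIFTS WITH `p^m` VANISHINGS.** For the slot-1 control map `g : H¹_nr(K_∞, M) → H¹_nr(K̃_∞, M)` ((C1)), a partner
`κ₂` unramified outside `𝔮 ∣ p`, and a decomposition element `τ₁ ∈ D_𝔮` with `κ τ₁ ≠ 1` (valuation `m`: `𝔮` finitely decomposed in
`K_∞ = K̄^{ker κ}`), a topological generator `γ`: a class `s ∈ H¹_nr(K̃_∞, M)` is in `im g` iff it has a lift `y ∈ H¹(K_∞, M)` (`res y = s`) with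
`res_{ker κ ⊓ I_𝔮}(conj_{(γⁿ)⁻¹} y) = 0` for every `n < p^m` ((C2a) `mem_range_lineRes_unr_iff_exists_lift` + §2). These `p^m` classes in
`H¹(ker κ ⊓ I_𝔮, M)` are the components of the `v̄`-defect of M-LINE-PIN. [cite: GreenbergVatsal2000, §2 pp. 17–21] [cite: GreenbergLNM1716, §3 Lemma 3.2]
[cite: NeukirchANT1999, Ch. I §9 p. 54] -/
theorem mem_range_lineRes_unr_iff_exists_lift_forall_lt (hκ₂ : κ₂.IsUnramifiedOutside 𝔮) (h𝔮 : ((p : ℕ) : 𝓞 K) ∈ 𝔮.asIdeal)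
    {τ₁ : absoluteGaloisGroup K} (hτ₁ : τ₁ ∈ decomp 𝔮) (hne : κ τ₁ ≠ 1) {γ : absoluteGaloisGroup K} (hγ : κ.IsTopGenerator γ)
    (s : unrSelmer₂ κ κ₂ M 𝔮) :
    s ∈ g.range ↔ ∃ y : subgroupH1 κ.kerSubgroup M,
      resOfLe M (ZpExtension.pairKer_le_left κ κ₂) y = (s : subgroupH1 (ZpExtension.pairKer κ κ₂) M) ∧
      ∀ n : ℕ, n < p ^ ((κ τ₁).toAdd).valuation →
        resOfLe M (inf_le_left : κ.kerSubgroup ⊓ inertia 𝔮 ≤ κ.kerSubgroup) (conjH1 κ.kerSubgroup M (γ ^ n)⁻¹ y) = 0 := by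
  rw [LinePinControl.mem_range_lineRes_unr_iff_exists_lift hg hκ₂ h𝔮 s]
  refine exists_congr fun y ↦ and_congr_right fun _ ↦ ?_
  exact forall_mem_greenbergKer_bdpData_iff_forall_lt κ M 𝔮 h𝔮 hτ₁ hne hγ y

end Summit.BirchSwinnertonDyer.BirchSwinnertonDyer.Theorems.PrintCf2.LinePinDefect

end
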